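import Summits.ResolutionOfSingularities.ResolutionOfSingularities.Theorems.MarkedTransferCampaignW46MohWindowShadeTerminalCentres
import HarnessLib

/-!
# [OURS · L1 W4.6] Rung (iii) "Moh window" for the classical pair — the TERMINAL case under minimal
  permissible coordinate centres: exit at the bottom edge and TERMINATION (all dimensions)

Cell `res-hironaka`, rung L, slot W4.6, seat `res-L1-s46-pv-6` (gen 2).  Sequel of
`MarkedTransferCampaignW46MohWindowShadeTerminalCentres.lean` (inside the window a terminal =
coordinate-monomial state blown up along any permissible coordinate centre `C_S`, `Σ_S r ≥ p`, is
terminal again at every point over the origin, equimultiple iff `p ≤ |r'|`, and `|r'| < |r|` when `S` is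
minimal at the chart index).  Model: the tree's coordinate-centre walk `CentreBlowup.CState/step` of
`PointBlowupShadeCentres.lean` ([HauserPerlega2019PRIMS, §2]; [Hauser2010, §§F–G]).  OURS; replaces — for
regime (iii) of RESCUE-SEED W4.6, the classical pair and the terminal case — the ROLE of the termination
clause of Th. 16.13 (ms. p. 87 l. 25–29) for the combinatorial resolution by minimal permissible centres
("the locus where it attains its maximal value defines a permissible center and it strictly decreases
when this center is blown up. Hence, the combinatorial resolution process terminates in finitely many
steps", [HauserPerlega2024, §3 (2)]); NOT a statement of the manuscript [claim: Hironaka2017, status: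
under-review], nothing of which is used.  AI review is weaker than expert review.

## What is proved (prime `p`, field `K` of char. `p`, finite `σ`)

* `not_isEquimultiplePoint_of_degree_eq` — THE BOTTOM EDGE: a cleaned terminal state of order `|r| = p`
  blown up along a centre `C_S ∋ j` with `Σ_S r ≥ p` and `Σ_{S∖{j}} r < p` has no equimultiple point over
  the origin in the chart `y_j` (near ⟹ ridge for centres, tree `CentreBlowup.nearOnDirectrixAtCentre` =
  [CJS 2020, Thm. 3.14] in the model, read through the polar of `F_p = c·y^r` at `y^{r − e_j}`, gen 0's
  `MohWindowShade.dvd_apply_of_polar_eq_zero`: `p ∣ r_j ≥ 1`, so `y^r = y_j^p`, deleted by the cleaning).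
* `length_le_of_minimalCentres` — TERMINATION: along any walk `s_{n+1} = step p (S n) (j n) (b n) (s n)`
  of MINIMAL permissible coordinate centres (`Σ_{S n} r_n ≥ p`, `Σ_{S n ∖ {i}} r_n < p` for `i ∈ S n`)
  read at points over the origin (`b n (j n) = 0`, `b n i = 0` off `S n`), from a cleaned terminal state
  inside the window (`p < |r| < 2p`), if the first `N` points are equimultiple then `N + p ≤ |r₀|` — fewer
  than `|r₀| − p < p` blow-ups of `p`-fold points.

Honest scope: given coordinates; points over the origin of each centre; `e = 1`.  Barriers:
`ResidualOrderUnboundedNarrow.mohStability_fails_for_each_e` (`e ≥ 3`); `PointBlowupMohBoundAttained`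
(`|r| = 2p`, excluded by the window).
-/

noncomputable section

set_option linter.dupNamespace false -- mandated namespace of this single-conjunct summit

open MvPolynomial Finset

open scoped BigOperators

namespace Summit.ResolutionOfSingularities.ResolutionOfSingularities.Theorems.CampaignW46.MohWindowShadeTerminalCentresExit

open Literature.AlgebraicGeometry.Resolution
open Literature.AlgebraicGeometry.Resolution.CentreBlowup
open Literature.AlgebraicGeometry.Resolution.Hauser2010
open Literature.AlgebraicGeometry.Resolution.HauserPerlega2019 (initialForm)
open Literature.Barriers.ResolutionOfSingularities (ordZero_le_of_coeff_ne_zero le_ordZero_of_forall)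

variable {σ : Type*} {K : Type*} [Field K] [Fintype σ] [DecidableEq σ] [DecidableEq K]
variable (p : ℕ) [hp : Fact p.Prime] [CharP K p]

/-! ## §1. The bottom edge above a minimal centre -/

omit [DecidableEq K] in
/-- **[OURS · L1 W4.6] No equimultiple point over the origin at the bottom edge.**  A cleaned terminal
state of order `|r| = p`, blown up along a MINIMAL permissible coordinate centre `C_S` (`j ∈ S`), has no
equimultiple point over the origin: the only degree-`p` monomial of `F` is `y^r`, the initial form
`c·y^r` would be additive along `e_j + Σ b_i e_i` (tree `CentreBlowup.nearOnDirectrixAtCentre`, [CJS 2020,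
Thm. 3.14] in the model), its polar `Σ_k v_k ∂_k` read at `y^{r − e_j}` gives `p ∣ r_j`, so `r_j = 0`
(as `y^r` is not a `p`-th power) — against minimality (`Σ_{S∖{j}} r < p ≤ Σ_S r`).  NOT a statement of
the manuscript. [folklore] -/
theorem not_isEquimultiplePoint_of_degree_eq {S : Finset σ} {j : σ} (hj : j ∈ S) (b : σ → K)
    (hbj : b j = 0) (hbN : ∀ i, i ∉ S → b i = 0) (s : CState σ K)
    (hclean : deletePthPowers p s.F = s.F) (hr : ∀ d ∈ s.F.support, s.r ≤ d)
    (hord : ordZero s.F = (s.r.degree : ℕ)) (hdeg : s.r.degree = p) (hS : p ≤ degIn S s.r)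
    (hminj : degIn (S.erase j) s.r < p) : ¬ IsEquimultiplePoint p S j b s := by
  classical
  intro heq
  have hordp : ordZero s.F = p := by rw [hord, hdeg]
  have hperm : (p : ℕ∞) ≤ ordAlong S s.F := by
    rw [(ordAlong_eq_of_perm S s hord hr (MohWindowShadeTerminalCentres.perm_of_terminal S s hr)).1]
    exact_mod_cast (by omega : p ≤ degIn S s.r + (s.r.degree - s.r.degree))
  have hadd : PointBlowup.AdditiveAlong (initialForm s.F) (PointBlowup.direction j b) :=
    nearOnDirectrixAtCentre p S j hj b hbj hbN s hordp hperm heq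
  -- the initial form is `c · y^r`
  have hΦdef : initialForm s.F = homogeneousComponent p s.F := by
    show homogeneousComponent (ordZero s.F).toNat s.F = _
    rw [hordp, ENat.toNat_coe]
  have hΦ : (initialForm s.F).IsHomogeneous p := by
    rw [hΦdef]; exact homogeneousComponent_isHomogeneous p s.F
  have hsupp : ∀ d ∈ (initialForm s.F).support, d = s.r := by
    intro d hd
    rw [hΦdef, MvPolynomial.mem_support_iff, coeff_homogeneousComponent] at hd
    by_cases hdd : d.degree = p
    · rw [if_pos hdd] at hd
      have hle : s.r ≤ d := hr d (MvPolynomial.mem_support_iff.mpr hd)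
      by_contra hne
      have := PointBlowup.degree_lt_degree_of_lt (lt_of_le_of_ne hle (Ne.symm hne))
      omega
    · rw [if_neg hdd] at hd; exact absurd rfl hd
  have hrmem : s.r ∈ (initialForm s.F).support := by
    rw [hΦdef, MvPolynomial.mem_support_iff, coeff_homogeneousComponent, if_pos hdeg]
    exact MohWindowShadeTerminalCentres.coeff_r_ne_zero s hr hord
  -- the polar vanishes
  have hpolar : ∑ i, PointBlowup.direction j b i • pderiv i (initialForm s.F) = 0 := by
    have hmem := (PointBlowup.mem_additiveSubspace_iff p hΦ (PointBlowup.direction j b)).mpr hadd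
    unfold PointBlowup.additiveSubspace at hmem
    rw [LinearMap.mem_ker] at hmem
    unfold PointBlowup.polarMap at hmem
    rw [Fintype.linearCombination_apply] at hmem
    exact hmem
  -- `r_j ≥ 1` by minimality, so `p ∣ r_j`, so `r_j = p` and `r = p • e_j`: a `p`-th power
  have hrj : 1 ≤ s.r j := by
    have h4 : degIn S s.r = s.r j + degIn (S.erase j) s.r := by
      unfold degIn; rw [← Finset.add_sum_erase S _ hj]
    omega
  have hdvd : p ∣ s.r j :=
    MohWindowShade.dvd_apply_of_polar_eq_zero p (k := j)
      (by rw [PointBlowup.direction, Function.update_self]; exact one_ne_zero) hpolar hrmem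
      (fun d hd => by rw [hsupp d hd]) hrj
  have hrjp : s.r j = p := by
    have hle : s.r j ≤ s.r.degree := by
      rw [Finsupp.degree_eq_sum]
      exact Finset.single_le_sum (fun i _ => Nat.zero_le (s.r i)) (Finset.mem_univ j)
    obtain ⟨c, hc⟩ := hdvd
    have hc1 : c = 1 := by
      rcases Nat.lt_or_ge c 1 with h | h
      · rw [show c = 0 by omega, mul_zero] at hc; omega
      · by_contra h2
        have : p * 2 ≤ p * c := Nat.mul_le_mul_left p (by omega); omega
    rw [hc, hc1, mul_one]
  have hPth : IsPthPowerExponent p s.r := by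
    rw [isPthPowerExponent_iff]
    intro i
    by_cases hij : i = j
    · rw [hij, hrjp]
    · have hsum := PointBlowup.degree_eq_add_sum_erase j s.r
      have hzero : ∑ l ∈ (Finset.univ : Finset σ).erase j, s.r l = 0 := by omega
      have hi0 : s.r i = 0 := by
        have hmem : i ∈ (Finset.univ : Finset σ).erase j :=
          Finset.mem_erase.mpr ⟨hij, Finset.mem_univ i⟩
        have := Finset.single_le_sum (f := fun l => s.r l) (fun l _ => Nat.zero_le (s.r l)) hmem
        rw [hzero] at this
        exact Nat.le_zero.mp this
      rw [hi0]; exact dvd_zero p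
  exact PointBlowup.not_isPthPowerExponent_of_clean p hclean
    (MvPolynomial.mem_support_iff.mpr (MohWindowShadeTerminalCentres.coeff_r_ne_zero s hr hord)) hPth

/-! ## §2. Termination of the combinatorial resolution inside the window -/

/-- **[OURS · L1 W4.6] TERMINATION of the terminal case under minimal permissible coordinate centres (all
dimensions).**  Let `s₀, s₁, …` be states with `s_{n+1} = step p (S n) (j n) (b n) (s n)`, where at each
stage `S n ∋ j n` is a MINIMAL set of exceptional components of total multiplicity `≥ p`
(`Σ_{S n ∖ {i}} r_n < p` for `i ∈ S n`) and `b n` is a point over the origin of the chart `y_{j n}`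
(`b n (j n) = 0`, `b n i = 0` off `S n`), starting from a cleaned terminal state inside the window
(`y^r ∣ F`, `ord₀ F = |r|`, `p < |r| < 2p`).  If the first `N` points are equimultiple then
`N + p ≤ |r₀|`: the order `|r|` drops at every step, the state stays terminal and cleaned, and the bottom
edge `|r| = p` admits no equimultiple point.  Replaces, for the classical pair in the terminal case, the
role of the termination clause of Th. 16.13 (p. 87) in regime (iii); NOT a statement of the manuscript.
[folklore] -/
theorem length_le_of_minimalCentres (s : ℕ → CState σ K) (S : ℕ → Finset σ) (j : ℕ → σ)
    (b : ℕ → σ → K) (hj : ∀ n, j n ∈ S n) (hb : ∀ n, b n (j n) = 0)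
    (hbN : ∀ n i, i ∉ S n → b n i = 0)
    (hstep : ∀ n, s (n + 1) = step p (S n) (j n) (b n) (s n))
    (hS : ∀ n, p ≤ degIn (S n) (s n).r)
    (hmin : ∀ n, ∀ i ∈ S n, degIn ((S n).erase i) (s n).r < p)
    (hclean : deletePthPowers p (s 0).F = (s 0).F) (hr : ∀ d ∈ (s 0).F.support, (s 0).r ≤ d)
    (hord : ordZero (s 0).F = ((s 0).r.degree : ℕ)) (hlo : p < (s 0).r.degree)
    (hhi : (s 0).r.degree < 2 * p) {N : ℕ}
    (heq : ∀ n, n < N → IsEquimultiplePoint p (S n) (j n) (b n) (s n)) :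
    N + p ≤ (s 0).r.degree := by
  classical
  have hinv : ∀ n, n ≤ N →
      deletePthPowers p (s n).F = (s n).F ∧ (∀ d ∈ (s n).F.support, (s n).r ≤ d) ∧
      ordZero (s n).F = ((s n).r.degree : ℕ) ∧ p ≤ (s n).r.degree ∧
      (s n).r.degree + n ≤ (s 0).r.degree := by
    intro n
    induction n with
    | zero => intro _; exact ⟨hclean, hr, hord, hlo.le, le_rfl⟩
    | succ n ih =>
      intro hn
      obtain ⟨h1, h2, h3, h5, h6⟩ := ih (by omega)
      have heqn := heq n (by omega)
      have hlt : p < (s n).r.degree := by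
        rcases h5.lt_or_eq with h | h
        · exact h
        · exact absurd heqn (not_isEquimultiplePoint_of_degree_eq p (hj n) (b n) (hb n) (hbN n) (s n)
            h1 h2 h3 h.symm (hS n) (hmin n (j n) (hj n)))
      have hhi' : (s n).r.degree < 2 * p := by omega
      rw [hstep n]
      refine ⟨deletePthPowers_step p (S n) (j n) (b n) (s n),
        newMult_le_of_mem_support_step p (S n) (j n) (b n) (hb n) (s n) h3 h2
          (MohWindowShadeTerminalCentres.perm_of_terminal (S n) (s n) h2),
        MohWindowShadeTerminalCentres.ordZero_step_eq p (hj n) (b n) (hb n) (hbN n) (s n) h2 h3 hlt hhi'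
          (hS n),
        (MohWindowShadeTerminalCentres.isEquimultiplePoint_iff p (hj n) (b n) (hb n) (hbN n) (s n) h2 h3
          hlt hhi' (hS n)).mp heqn,
        ?_⟩
      have := MohWindowShadeTerminalCentres.degree_step_r_lt p (S n) (j n) (b n) (hb n) (s n) h2 h3
        (hS n) (hmin n (j n) (hj n))
      omega
  obtain ⟨-, -, -, h5, h6⟩ := hinv N le_rfl
  omega

end Summit.ResolutionOfSingularities.ResolutionOfSingularities.Theorems.CampaignW46.MohWindowShadeTerminalCentresExit
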